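import Summits.Ventures.YMGap.RobustBall.UniformMassGapKR
import Summits.Ventures.YMGap.RobustBall.UniformMassGapZdG
import Summits.Ventures.YMGap.RobustBall.MassGapOnBallZdGRowsSUN
import HarnessLib

/-!
# Venture YMGap, track ROBUST-BALL (Y2) — uniform rows for every `N` and for `SU(3)` HYPOTHESIS-FREE (eigen modulus)

HONEST FRAMING. WHAT THIS IS: a venture file (cell `pub-ymgap`, track Y2 ROBUST-BALL, seat rb-p1, theorems only):
* every `N ≥ 2`, tier 1, `ℤ⁴`, 't Hooft `|β| ≤ 1/64`, HYPOTHESIS-FREE (Bakry–Émery pair): `suN_uniformZdRow4_1_64 :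
  UniformMassGapOnBallZd 4 N β (1/10) (1/20) R ((1/8)/max(1,R)) (16N)` — on the tier-1 ball of radii `(1/10, 1/20)` and range `R`
  every member has one DLR state and ALL of them cluster at rate `(1/8)/max(1,R)` with constant `16N n²` (row sum `≤ 7/8`);
* ds-2's every-`N` robust-star schema on p2's eigen modulus, uniformly: `suN_uniformMassGapOnBallZdG_star_eigen` (ds-2's
  `suN_massGapOnBallZdG_star_eigen` + a round bound `ρ ≤ ρ₀ < 1` ⇒ rate `starRate 4 ρ₀/(max R 1 + 4)`, constant `32N`);
* `SU(3)`, `d = 4`, HYPOTHESIS-FREE (no H1/H2), gauge ball at `β_W = 1/8` ('t Hooft `1/72`): quarter radius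
  `su3_uniformStar_oneEighth_quarterRadius (R) : UniformMassGapOnBallZdG 4 3 (1/72) (37/500) (37/1000) R ((1/26)/(max R 1 + 4)) 96`
  (received sum `≤ 31/100`), half radius `su3_uniformStar_oneEighth_halfRadius` (`(37/250, 37/500)`, `ρ₀ = 47/100`, rate `(1/61)/(…)`).
WHAT THIS IS NOT: rates are Dobrushin-comparison lower bounds on the inverse correlation length; strong-coupling LATTICE statements,
nothing about the continuum limit or a Clay-sense mass gap. Certificates: `HOME/rb/certs/UNIFORM-RATES-rbp1.md` (addendum SUN).
-/

noncomputable section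

open MeasureTheory Filter Function ProbabilityTheory Real Topology
open scoped NNReal
open Literature.Probability.LatticeModels
open Literature.Probability.LatticeModels.DobrushinMetric
open Literature.MathematicalPhysics.QuantumLattice
open Literature.MathematicalPhysics.QuantumFieldTheory hiding ZdEdge Site
open Literature.MathematicalPhysics.QuantumFieldTheory.Balaban1983to89.StrongCouplingDobrushinWindow
  (OneLinkKRModulus)
open Summit.Ventures.YMGap.StarResolventDim (Delta gaugeR doorPoly gaugeR_lt_one_of_door)

namespace Summit.Ventures.YMGap.RobustBall

/-! ### Every `N ≥ 2`: the tier-1 `ℤ⁴` ball at 't Hooft `|β| ≤ 1/64`, uniformly -/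

/-- **ALL `N ≥ 2`, `ℤ⁴`, 't Hooft `|β| ≤ 1/64`, HYPOTHESIS-FREE, UNIFORM**: `UniformMassGapOnBallZd 4 N β (1/10) (1/20) R ((1/8)/max(1,R)) (16N)`
(Bakry–Émery pair, `b = 6|β| ≤ 3/32`; row sum `18|β| e^{1/10}/(1/2 − 6|β|) + e^{1/20}(1/20)/√(N(1/2 − 6|β|)) ≤ 0.824 ≤ 7/8`). [folklore] -/
theorem suN_uniformZdRow4_1_64 {N : ℕ} (hN : 2 ≤ N) {β : ℝ} (hβ : |β| ≤ 1 / 64) (R : ℝ) :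
    UniformMassGapOnBallZd 4 N β (2 * (1 / 20)) (1 / 20) R ((1 - 7 / 8) / max 1 R) (16 * N) := by
  have hN2 : (2 : ℝ) ≤ N := by exact_mod_cast hN
  have hβ0 := abs_nonneg β
  have hb : |β| * (2 * (((4 : ℕ) : ℝ) - 1)) < 1 / 2 := by norm_num; linarith
  refine suN_uniformMassGapOnBallZd_bakryEmery (d := 4) (by norm_num) hN R hb ?_ (by norm_num) (by norm_num)
  have h1 := exp_le_taylor4 (x := 2 * (1 / 20)) (by norm_num) (by norm_num)
  have h2 := exp_le_taylor4 (x := 2 * (1 / 20) / 2) (by norm_num) (by norm_num)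
  have hgap : 13 / 32 ≤ 1 / 2 - |β| * (2 * (((4 : ℕ) : ℝ) - 1)) := by norm_num; linarith
  have hgap0 : 0 < 1 / 2 - |β| * (2 * (((4 : ℕ) : ℝ) - 1)) := by linarith
  have hs : (901 / 1000 : ℝ) ≤ Real.sqrt ((N : ℝ) * (1 / 2 - |β| * (2 * (((4 : ℕ) : ℝ) - 1)))) := by
    refine sqrt_thirteen_sixteenths_ge.trans (Real.sqrt_le_sqrt ?_)
    nlinarith
  have hs0 : (0 : ℝ) < Real.sqrt ((N : ℝ) * (1 / 2 - |β| * (2 * (((4 : ℕ) : ℝ) - 1)))) := by linarith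
  have hsecond : exp (2 * (1 / 20) / 2) * (1 / 20) / Real.sqrt ((N : ℝ) * (1 / 2 - |β| * (2 * (((4 : ℕ) : ℝ) - 1)))) ≤
      (1 + 2 * (1 / 20) / 2 + (2 * (1 / 20) / 2) ^ 2 / 2 + (2 * (1 / 20) / 2) ^ 3 / 6 + 5 / 96 * (2 * (1 / 20) / 2) ^ 4) *
        (1 / 20) / (901 / 1000) := by
    rw [div_le_div_iff₀ hs0 (by norm_num)]
    have he0 : 0 < exp (2 * (1 / 20) / 2) := exp_pos _
    nlinarith [hs, h2, he0]
  have hfirst : 6 * (((4 : ℕ) : ℝ) - 1) * |β| * exp (2 * (1 / 20)) / (1 / 2 - |β| * (2 * (((4 : ℕ) : ℝ) - 1))) ≤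
      6 * 3 * (1 / 64) * (1 + 2 * (1 / 20) + (2 * (1 / 20)) ^ 2 / 2 + (2 * (1 / 20)) ^ 3 / 6 + 5 / 96 * (2 * (1 / 20)) ^ 4) /
        (13 / 32) := by
    rw [div_le_div_iff₀ hgap0 (by norm_num)]
    have he1 : 0 < exp (2 * (1 / 20)) := exp_pos _
    push_cast
    nlinarith [h1, he1, hβ0, hβ, hgap, mul_nonneg hβ0 he1.le]
  calc 6 * (((4 : ℕ) : ℝ) - 1) * |β| * exp (2 * (1 / 20)) / (1 / 2 - |β| * (2 * (((4 : ℕ) : ℝ) - 1))) +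
        exp (2 * (1 / 20) / 2) * (1 / 20) / Real.sqrt ((N : ℝ) * (1 / 2 - |β| * (2 * (((4 : ℕ) : ℝ) - 1))))
      ≤ 6 * 3 * (1 / 64) * (1 + 2 * (1 / 20) + (2 * (1 / 20)) ^ 2 / 2 + (2 * (1 / 20)) ^ 3 / 6 + 5 / 96 * (2 * (1 / 20)) ^ 4) /
          (13 / 32) +
        (1 + 2 * (1 / 20) / 2 + (2 * (1 / 20) / 2) ^ 2 / 2 + (2 * (1 / 20) / 2) ^ 3 / 6 + 5 / 96 * (2 * (1 / 20) / 2) ^ 4) *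
          (1 / 20) / (901 / 1000) := add_le_add hfirst hsecond
    _ ≤ 7 / 8 := by norm_num

/-! ### Every `N ≥ 2`: ds-2's robust-star schema on the eigen modulus, uniformly -/

/-- **SCHEMA, every `N ≥ 2`, `d = 4`, eigen modulus, UNIFORM** (ds-2's `suN_massGapOnBallZdG_star_eigen` with constants exposed):
under its hypotheses and a round bound `gaugeR 4 c + (λ + (6c+λ)^Kn·16λ)/(1 − (6c+λ)) ≤ ρ₀ < 1`:
`UniformMassGapOnBallZdG 4 N (β_W/N²) ε₀ ε₁ R (starRate 4 ρ₀/(max R 1 + 4)) (32N)`. [folklore] -/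
theorem suN_uniformMassGapOnBallZdG_star_eigen (Kn : ℕ) {N : ℕ} (hN : 2 ≤ N) {βW ε₀ ε₁ c lam E S Kb ρ₀ : ℝ}
    (hβ0 : 0 ≤ βW) (hR : βW / (N : ℝ) ^ 2 * 6 < 1 / 2) (hε₁ : 0 ≤ ε₁) (hE : Real.exp ε₀ ≤ E)
    (hS : Real.sqrt N ≤ S) (hKb : (N : ℝ) ^ 2 / ((N : ℝ) ^ 2 - 1) * ((1 / 2 + 2 * (βW / (N : ℝ) ^ 2 * 6)) /
      (1 / 2 - βW / (N : ℝ) ^ 2 * 6)) ≤ Kb)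
    (hc : Kb * E * (1 + 2 * S * ε₁) * (βW / (N : ℝ) ^ 2) ≤ c) (hlam : S * ε₁ ≤ lam) (hθ1 : 6 * c + lam < 1)
    (hcd : doorPoly 4 c < 1)
    (hρ0 : gaugeR 4 c + (lam + (6 * c + lam) ^ Kn * (16 * lam)) / (1 - (6 * c + lam)) ≤ ρ₀) (hρ1 : ρ₀ < 1)
    (R : ℕ) : UniformMassGapOnBallZdG 4 N (βW / (N : ℝ) ^ 2) ε₀ ε₁ R (starRate 4 ρ₀ / (max R 1 + 4 : ℕ)) (32 * N) := by
  have hN1 : 1 ≤ N := by omega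
  have hNpos : (0 : ℝ) < N := by exact_mod_cast (show 0 < N by omega)
  have hN2 : (2 : ℝ) ≤ N := by exact_mod_cast hN
  set Rm : ℝ := βW / (N : ℝ) ^ 2 * 6 with hRdef
  set K : ℝ := (N : ℝ) ^ 2 / ((N : ℝ) ^ 2 - 1) * ((1 / 2 + 2 * Rm) / (1 / 2 - Rm)) with hKdef
  have hmod : OneLinkKRModulus N Rm K := OneLinkEigen.oneLinkKRModulus_eigen hN hR
  have hK0 : 0 ≤ K := by
    have h1 : (0 : ℝ) < (N : ℝ) ^ 2 - 1 := by nlinarith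
    have h2 : (0 : ℝ) < 1 / 2 - Rm := by linarith
    positivity
  have hS0 : 0 ≤ S := (Real.sqrt_nonneg _).trans hS
  have hE0 : 0 ≤ E := (Real.exp_pos _).le.trans hE
  have hKb0 : 0 ≤ Kb := hK0.trans hKb
  set θ : ℝ := 6 * c + lam with hθ
  set ρ : ℝ := gaugeR 4 c + (lam + θ ^ Kn * (16 * lam)) / (1 - θ) with hρ
  have habs : |(N : ℝ) * (βW / (N : ℝ) ^ 2)| / (N : ℝ) = βW / (N : ℝ) ^ 2 := by
    rw [abs_of_nonneg (by positivity)]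
    field_simp
  have hR' : |(N : ℝ) * (βW / (N : ℝ) ^ 2)| / (N : ℝ) * (2 * (((4 : ℕ) : ℝ) - 1)) ≤ Rm := by
    rw [habs, hRdef]; norm_num
  have hc' : K * Real.exp ε₀ * (1 + 2 * Real.sqrt N * ε₁) * (|(N : ℝ) * (βW / (N : ℝ) ^ 2)| / (N : ℝ)) ≤ c := by
    refine le_trans ?_ hc
    rw [habs]
    have hb : 0 ≤ βW / (N : ℝ) ^ 2 := by positivity
    have h2 : 1 + 2 * Real.sqrt N * ε₁ ≤ 1 + 2 * S * ε₁ := by nlinarith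
    have h3 : 0 ≤ 1 + 2 * Real.sqrt N * ε₁ := by positivity
    calc K * Real.exp ε₀ * (1 + 2 * Real.sqrt N * ε₁) * (βW / (N : ℝ) ^ 2)
        ≤ Kb * E * (1 + 2 * Real.sqrt N * ε₁) * (βW / (N : ℝ) ^ 2) := by gcongr
      _ ≤ Kb * E * (1 + 2 * S * ε₁) * (βW / (N : ℝ) ^ 2) := by gcongr
  have hlam' : Real.sqrt N * ε₁ ≤ lam := le_trans (mul_le_mul_of_nonneg_right hS hε₁) hlam
  have hθ' : θ = (2 * ((4 : ℕ) : ℝ) - 2) * c + lam := by rw [hθ]; push_cast; ring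
  have hρ' : ρ = gaugeR 4 c + (lam + θ ^ Kn * (4 * ((4 : ℕ) : ℝ) * lam)) / (1 - θ) := by rw [hρ]; push_cast; ring
  exact uniformMassGapOnBallZdG_of_robustStar (d := 4) (N := N) (by norm_num) hN1 hK0 hR' hmod hε₁ hc' hlam' hθ' hθ1
    hcd hρ' hρ0 hρ1

/-! ### `SU(3)`, `d = 4`, hypothesis-free: cells with a legible rate at `β_W = 1/8` -/

/-- **CELL `SU(3)`, `β_W = 1/8` ('t Hooft `1/72`), QUARTER RADIUS `(37/500, 37/1000)`, HYPOTHESIS-FREE**: received sum `≤ 31/100` ⇒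
`UniformMassGapOnBallZdG 4 3 (1/72) (37/500) (37/1000) R ((1/26)/(max R 1 + 4)) 96` (eigen modulus `K = 9/5`; certificate
`c = 30371/1000000`, `λ = 64087/1000000`, `E = T₄(37/500)`, `√3 ≤ 1.73206`; `starRate 4 (31/100) ≥ 1/26`). [folklore] -/
theorem su3_uniformStar_oneEighth_quarterRadius (R : ℕ) :
    UniformMassGapOnBallZdG 4 3 (1 / 72) (37 / 500) (37 / 1000) R ((1 / 26 : ℝ) / (max R 1 + 4 : ℕ)) 96 := by
  have e1 : (1 / 8 : ℝ) / ((3 : ℕ) : ℝ) ^ 2 = 1 / 72 := by norm_num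
  have hS : Real.sqrt ((3 : ℕ) : ℝ) ≤ 1.73206 := by
    have : ((3 : ℕ) : ℝ) = 3 := by norm_num
    rw [this]; exact sqrt_three_le
  have h := suN_uniformMassGapOnBallZdG_star_eigen 20 (N := 3) (by norm_num) (βW := 1 / 8) (ε₀ := 37 / 500)
    (ε₁ := 37 / 1000) (c := 30371 / 1000000) (lam := 64087 / 1000000) (S := 1.73206) (Kb := 9 / 5) (ρ₀ := 31 / 100)
    (by norm_num) (by norm_num) (by norm_num) (exp_le_taylor4 (x := 37 / 500) (by norm_num) (by norm_num)) hS (by norm_num)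
    (by norm_num) (by norm_num) (by norm_num) (by unfold doorPoly; norm_num) (by unfold gaugeR Delta; norm_num) (by norm_num) R
  rw [e1] at h
  have hrate : (1 / 26 : ℝ) ≤ starRate 4 (31 / 100) := by unfold starRate; norm_num
  have hD : (0 : ℝ) < ((max R 1 + 4 : ℕ) : ℝ) := by positivity
  have h96 : (32 * ((3 : ℕ) : ℝ) : ℝ) = 96 := by norm_num
  rw [h96] at h
  exact h.mono le_rfl le_rfl le_rfl (by positivity) (div_le_div_of_nonneg_right hrate hD.le) le_rfl (by norm_num)

/-- **CELL `SU(3)`, `β_W = 1/8`, HALF RADIUS `(37/250, 37/500)`, HYPOTHESIS-FREE**: received sum `≤ 47/100` ⇒ rate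
`(1/61)/(max R 1 + 4)`, constant `96` (certificate `c = 36419/1000000`, `λ = 128173/1000000`). [folklore] -/
theorem su3_uniformStar_oneEighth_halfRadius (R : ℕ) :
    UniformMassGapOnBallZdG 4 3 (1 / 72) (37 / 250) (37 / 500) R ((1 / 61 : ℝ) / (max R 1 + 4 : ℕ)) 96 := by
  have e1 : (1 / 8 : ℝ) / ((3 : ℕ) : ℝ) ^ 2 = 1 / 72 := by norm_num
  have hS : Real.sqrt ((3 : ℕ) : ℝ) ≤ 1.73206 := by
    have : ((3 : ℕ) : ℝ) = 3 := by norm_num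
    rw [this]; exact sqrt_three_le
  have h := suN_uniformMassGapOnBallZdG_star_eigen 20 (N := 3) (by norm_num) (βW := 1 / 8) (ε₀ := 37 / 250)
    (ε₁ := 37 / 500) (c := 36419 / 1000000) (lam := 128173 / 1000000) (S := 1.73206) (Kb := 9 / 5) (ρ₀ := 47 / 100)
    (by norm_num) (by norm_num) (by norm_num) (exp_le_taylor4 (x := 37 / 250) (by norm_num) (by norm_num)) hS (by norm_num)
    (by norm_num) (by norm_num) (by norm_num) (by unfold doorPoly; norm_num) (by unfold gaugeR Delta; norm_num) (by norm_num) R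
  rw [e1] at h
  have hrate : (1 / 61 : ℝ) ≤ starRate 4 (47 / 100) := by unfold starRate; norm_num
  have hD : (0 : ℝ) < ((max R 1 + 4 : ℕ) : ℝ) := by positivity
  have h96 : (32 * ((3 : ℕ) : ℝ) : ℝ) = 96 := by norm_num
  rw [h96] at h
  exact h.mono le_rfl le_rfl le_rfl (by positivity) (div_le_div_of_nonneg_right hrate hD.le) le_rfl (by norm_num)

end Summit.Ventures.YMGap.RobustBall

end
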